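import Summits.FinalStateConjecture.FinalStateConjecture.Theorems.EIHFluxBalanceRecedingWellsFiniteSpeed

/-!
# Route EIHFluxBalance — `RecedingWellsEnergyBound`: the two energy estimates

Fifth helper file for the support item stmt-FinalStateConjecture-10168
(`Summit.FinalStateConjecture.FinalStateConjecture.Theses.EIHFluxBalance.RecedingWellsEnergyBound`).
For a `C²` solution `u` of `u_tt − u_xx + W u = 0` (`W ≥ 0` of class `C¹`, `∂ₜW ≤ B`) with Cauchy
data supported in `|y| ≤ R₁`, the total energy `E(t) = ∫ (u_t² + u_x² + W u²)(t, ·)` (a genuine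
integral: everything vanishes for `|y| ≥ R₁ + t` by finite speed) obeys:

* `energy_early_le` — **Grönwall-type bound with a cut-off mass term**: if `0 ≤ χ ≤ 1` is `C¹` and
  `∂ₜW ≤ B χ` on `[0, T] × ℝ` (`B ≥ 0`), then `E(t) ≤ e^{(B+2)t} (E(0) + ∫ χ u(0,·)²)` for
  `t ∈ [0, T]` (the pair `q = e^{−Kt}(e + χ u²)`, `g = −e^{−Kt} m` has non-positive divergence);
* `energy_late_le` — **the Doppler multiplier**: if a `C¹` weight `β` satisfies on `[T₁, T₂] × ℝ`
  `|β| ≤ v`, `|β_t| ≤ β_x`, `β_x W = 0` and `W_t + β W_x = 0` (β equals the well velocity on each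
  well and interpolates causally in the potential-free gap), then
  `(1 − v) E(T₂) ≤ (1 + v) E(T₁)` (the pair `q = e + β m`, `g = −(m + β n)` has divergence
  `β_t m − β_x (u_t² + u_x²) ≤ 0` and `(1 − v) e ≤ q ≤ (1 + v) e`).

Both are instances of `divergence_weighted` + `integral_rect_le`.  Standard material [folklore].
-/

namespace Summit.FinalStateConjecture.FinalStateConjecture.Theorems

open MeasureTheory Set Filter Topology intervalIntegral

noncomputable section

namespace MovingWells

open WaveEnergy

variable {u W : ℝ × ℝ → ℝ}

/-- A function vanishing for `|y| ≥ L` integrates over `ℝ` as over `[−L, L]`. -/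
theorem integral_eq_intervalIntegral_of_abs {F : ℝ → ℝ} {L : ℝ} (hF : ∀ y, L ≤ |y| → F y = 0) :
    ∫ y, F y = ∫ y in (-L)..L, F y := by
  symm
  apply intervalIntegral.integral_eq_integral_of_support_subset
  intro y hy
  rw [Function.mem_support] at hy
  by_contra hmem
  apply hy
  apply hF
  rw [mem_Ioc, not_and_or, not_lt, not_le] at hmem
  rcases hmem with h | h
  · exact le_trans (by linarith) (neg_le_abs y)
  · exact le_trans h.le (le_abs_self y)

/-- Partial `σ_t` of the cut-off weight `σ(t, x) = e^{−Kt} χ(x)`: `σ_t = −K σ`. -/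
theorem fderiv_expWeight_mul (K : ℝ) {χ : ℝ → ℝ} (hχ : Differentiable ℝ χ) (t x : ℝ) :
    fderiv ℝ (fun z : ℝ × ℝ => Real.exp (-K * z.1) * χ z.2) (t, x) (1, 0)
      = -K * (Real.exp (-K * t) * χ x) := by
  have hσ : Differentiable ℝ (fun z : ℝ × ℝ => Real.exp (-K * z.1) * χ z.2) := by fun_prop
  have h : HasDerivAt (fun τ : ℝ => Real.exp (-K * τ) * χ x)
      (Real.exp (-K * t) * (-K * 1) * χ x) t :=
    (((hasDerivAt_id t).const_mul (-K))).exp.mul_const (χ x)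
  have h' := (hasDerivAt_slice_fst hσ t x).unique h
  rw [h']
  ring

/-- The pointwise inequality behind `energy_early_le`: with `K = B + 2`, `0 ≤ χ ≤ 1`,
`W_t ≤ B χ` and `u_t² + u_x² ≤ e`, the source `−K e + W_t u² − K χ u² + 2 χ u u_t` is `≤ 0`. -/
theorem early_source_nonpos {K B Wt e ut ux w c : ℝ} (hK : K = B + 2) (hB0 : 0 ≤ B)
    (hc0 : 0 ≤ c) (hc1 : c ≤ 1) (hWt : Wt ≤ B * c) (he : ut ^ 2 + ux ^ 2 ≤ e) :
    -K * e + Wt * w ^ 2 - K * c * w ^ 2 + 2 * c * w * ut ≤ 0 := by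
  have h1 : Wt * w ^ 2 ≤ B * c * w ^ 2 := mul_le_mul_of_nonneg_right hWt (sq_nonneg _)
  have h2 : 2 * c * w * ut ≤ c * (w ^ 2 + ut ^ 2) := by nlinarith [sq_nonneg (w - ut)]
  have h3 : 0 ≤ e := le_trans (by positivity) he
  have h4 : 0 ≤ (1 - c) * ut ^ 2 := mul_nonneg (by linarith) (sq_nonneg _)
  have h5 : 0 ≤ c * w ^ 2 := mul_nonneg hc0 (sq_nonneg _)
  have h6 : 0 ≤ B * e := mul_nonneg hB0 h3
  have h7 : 0 ≤ ux ^ 2 := sq_nonneg _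
  subst hK
  nlinarith

/-- **Early-time energy bound (Grönwall with a cut-off mass term).** Let `u` be a `C²` solution of
`u_tt − u_xx + W u = 0` with `W ≥ 0` of class `C¹`, `∂ₜ W ≤ B` everywhere (`B ≥ 0`), Cauchy data
vanishing for `|y| ≥ R₁`, and let `χ` be `C¹` with `0 ≤ χ ≤ 1` and `∂ₜ W ≤ B χ` on `[0, T] × ℝ`.
Then for `t ∈ [0, T]`:
`∫ e(t,·) ≤ e^{(B+2)t} (∫ e(0,·) + ∫ χ u(0,·)²)`, `e = u_t² + u_x² + W u²`. [folklore] -/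
theorem energy_early_le (hu : ContDiff ℝ 2 u) (hW : ContDiff ℝ 1 W) (hW0 : ∀ z, 0 ≤ W z)
    {B : ℝ} (hB0 : 0 ≤ B) (hB : ∀ z, fderiv ℝ W z (1, 0) ≤ B)
    (hsol : ∀ z : ℝ × ℝ, fderiv ℝ (fderiv ℝ u) z (1, 0) (1, 0)
      - fderiv ℝ (fderiv ℝ u) z (0, 1) (0, 1) + W z * u z = 0)
    {e : ℝ × ℝ → ℝ}
    (he : ∀ z, e z = (fderiv ℝ u z (1, 0)) ^ 2 + (fderiv ℝ u z (0, 1)) ^ 2 + W z * u z ^ 2)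
    {R₁ : ℝ} (hdata : ∀ y, R₁ ≤ |y| → u (0, y) = 0 ∧ fderiv ℝ u (0, y) (1, 0) = 0)
    {χ : ℝ → ℝ} (hχ : ContDiff ℝ 1 χ) (hχ0 : ∀ x, 0 ≤ χ x) (hχ1 : ∀ x, χ x ≤ 1)
    {T : ℝ} (hWχ : ∀ t ∈ Icc 0 T, ∀ x, fderiv ℝ W (t, x) (1, 0) ≤ B * χ x)
    {t : ℝ} (ht : t ∈ Icc 0 T) :
    ∫ x, e (t, x) ≤ Real.exp ((B + 2) * t) * ((∫ x, e (0, x)) + ∫ x, χ x * u (0, x) ^ 2) := by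
  have hWd : Differentiable ℝ W := hW.differentiable (by norm_num)
  have hχd : Differentiable ℝ χ := hχ.differentiable (by norm_num)
  have hud := differentiable_of_contDiff_two hu
  set K : ℝ := B + 2 with hK
  set m : ℝ × ℝ → ℝ := fun z => 2 * fderiv ℝ u z (1, 0) * fderiv ℝ u z (0, 1) with hm_def
  set n : ℝ × ℝ → ℝ := fun z =>
    (fderiv ℝ u z (1, 0)) ^ 2 + (fderiv ℝ u z (0, 1)) ^ 2 - W z * u z ^ 2 with hn_def
  have hm : ∀ z, m z = 2 * fderiv ℝ u z (1, 0) * fderiv ℝ u z (0, 1) := fun z => rfl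
  have hn : ∀ z, n z = (fderiv ℝ u z (1, 0)) ^ 2 + (fderiv ℝ u z (0, 1)) ^ 2 - W z * u z ^ 2 :=
    fun z => rfl
  set ρ : ℝ × ℝ → ℝ := fun z => Real.exp (-K * z.1) with hρ_def
  set σ : ℝ × ℝ → ℝ := fun z => Real.exp (-K * z.1) * χ z.2 with hσ_def
  have hρd : Differentiable ℝ ρ := by simp only [hρ_def]; fun_prop
  have hσd : Differentiable ℝ σ := by simp only [hσ_def]; fun_prop
  set q : ℝ × ℝ → ℝ := fun z => ρ z * e z + σ z * u z ^ 2 + (0 : ℝ) * m z with hq_def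
  set g : ℝ × ℝ → ℝ := fun z => -(ρ z * m z + (0 : ℝ) * n z) with hg_def
  have hq : ∀ z, q z = ρ z * e z + σ z * u z ^ 2 + (fun _ => (0 : ℝ)) z * m z := fun z => rfl
  have hg : ∀ z, g z = -(ρ z * m z + (fun _ => (0 : ℝ)) z * n z) := fun z => rfl
  have hqd := differentiable_weighted hu hWd he hm hρd hσd (differentiable_const 0) hq
  have hgd := differentiable_weightedFlux hu hWd hm hn hρd (differentiable_const 0) hg
  -- the source
  set d : ℝ × ℝ → ℝ := fun z => ρ z * (-K * e z + fderiv ℝ W z (1, 0) * u z ^ 2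
    - K * χ z.2 * u z ^ 2 + 2 * χ z.2 * u z * fderiv ℝ u z (1, 0)) with hd_def
  have hdiv : ∀ z, fderiv ℝ q z (1, 0) + fderiv ℝ g z (0, 1) = d z := by
    intro z
    rw [divergence_weighted hu hWd hsol he hm hn hρd hσd (differentiable_const 0) hq hg z]
    obtain ⟨t', x'⟩ := z
    have h1 : fderiv ℝ ρ (t', x') (1, 0) = -K * ρ (t', x') := (fderiv_expWeight K t' x').1
    have h2 : fderiv ℝ ρ (t', x') (0, 1) = 0 := (fderiv_expWeight K t' x').2
    have h3 : fderiv ℝ σ (t', x') (1, 0) = -K * (ρ (t', x') * χ x') :=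
      fderiv_expWeight_mul K hχd t' x'
    have h0 : fderiv ℝ (fun _ : ℝ × ℝ => (0 : ℝ)) (t', x') = 0 := by simp
    simp only [hd_def, hσ_def, hρ_def, h0, zero_apply, zero_mul, add_zero, sub_zero] at h1 h2 h3 ⊢
    rw [h1, h2, h3]
    ring
  have hdc : Continuous d := by
    have h1 := continuous_fderiv_apply hu (1, 0)
    have h2 := continuous_energy hu hW.continuous he
    have h3 : Continuous fun z : ℝ × ℝ => fderiv ℝ W z (1, 0) :=
      (hW.continuous_fderiv (by norm_num)).clm_apply continuous_const
    have h4 := hχ.continuous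
    simp only [hd_def, hρ_def]
    fun_prop
  have hdneg : ∀ s ∈ Icc 0 T, ∀ x, d (s, x) ≤ 0 := fun s hs x =>
    mul_nonpos_of_nonneg_of_nonpos (Real.exp_pos _).le
      (early_source_nonpos hK hB0 (hχ0 x) (hχ1 x) (hWχ s hs x)
        (kinetic_le_energy hW0 he (s, x)))
  -- supports
  set L : ℝ := |R₁| + T + 1 with hL
  have hL0 : 0 ≤ L := by have := abs_nonneg R₁; linarith [ht.1, ht.2]
  have hvan : ∀ s, 0 ≤ s → s ≤ T → ∀ y, L ≤ |y| → ∀ w, u (s, y) = 0 ∧ fderiv ℝ u (s, y) w = 0 :=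
    fun s hs hsT y hy w => eq_zero_of_abs_ge hu hW hW0 hB hsol hdata hs
      (le_trans (by linarith [le_abs_self R₁]) hy) w
  -- monotonicity of the weighted energy between fixed ends
  have key := integral_rect_le hqd hgd hdc hdiv hL0 ht.1
    (fun s hs x _ => hdneg s ⟨hs.1, hs.2.trans ht.2⟩ x)
    (fun s hs => by
      have hp := (hvan s hs.1 (hs.2.trans ht.2) L (le_abs_self L) (1, 0)).2
      have hn' := (hvan s hs.1 (hs.2.trans ht.2) (-L) (by simp [abs_neg, le_abs_self]) (1, 0)).2
      simp only [hg_def, hm_def, hp, hn']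
      ring)
  -- lower bound at time `t`, evaluation at time `0`
  have hec : Continuous e := continuous_energy hu hW.continuous he
  have hlow : Real.exp (-K * t) * (∫ x in (-L)..L, e (t, x)) ≤ ∫ x in (-L)..L, q (t, x) := by
    rw [← intervalIntegral.integral_const_mul]
    refine intervalIntegral.integral_mono_on (by linarith) ?_ ?_ fun x _ => ?_
    · exact ((hec.comp (Continuous.prodMk_right t)).const_mul _).intervalIntegrable _ _
    · exact (hqd.continuous.comp (Continuous.prodMk_right t)).intervalIntegrable _ _
    · simp only [hq_def, hρ_def, hσ_def]
      nlinarith [mul_nonneg (mul_nonneg (Real.exp_pos (-K * t)).le (hχ0 x)) (sq_nonneg (u (t, x)))]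
  have hzero : (∫ x in (-L)..L, q (0, x))
      = (∫ x in (-L)..L, e (0, x)) + ∫ x in (-L)..L, χ x * u (0, x) ^ 2 := by
    rw [← intervalIntegral.integral_add]
    · refine intervalIntegral.integral_congr fun x _ => ?_
      simp [hq_def, hρ_def, hσ_def]
    · exact (hec.comp (Continuous.prodMk_right 0)).intervalIntegrable _ _
    · exact ((hχ.continuous.mul ((hud.continuous.comp (Continuous.prodMk_right 0)).pow 2))
        ).intervalIntegrable _ _
  -- whole-line integrals
  have hE_t : ∫ x, e (t, x) = ∫ x in (-L)..L, e (t, x) := by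
    refine integral_eq_intervalIntegral_of_abs fun y hy => ?_
    have h := hvan t ht.1 ht.2 y hy
    rw [he, (h (1, 0)).2, (h (0, 1)).2, (h (1, 0)).1]
    ring
  have hE_0 : ∫ x, e (0, x) = ∫ x in (-L)..L, e (0, x) := by
    refine integral_eq_intervalIntegral_of_abs fun y hy => ?_
    have h := hvan 0 le_rfl (ht.1.trans ht.2) y hy
    rw [he, (h (1, 0)).2, (h (0, 1)).2, (h (1, 0)).1]
    ring
  have hM_0 : ∫ x, χ x * u (0, x) ^ 2 = ∫ x in (-L)..L, χ x * u (0, x) ^ 2 := by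
    refine integral_eq_intervalIntegral_of_abs fun y hy => ?_
    rw [(hvan 0 le_rfl (ht.1.trans ht.2) y hy (1, 0)).1]
    ring
  rw [hE_t, hE_0, hM_0, ← hzero]
  have hexp : Real.exp ((B + 2) * t) * Real.exp (-K * t) = 1 := by
    have h0 : (B + 2) * t + -K * t = 0 := by rw [hK]; ring
    rw [← Real.exp_add, h0, Real.exp_zero]
  have hpos : 0 < Real.exp ((B + 2) * t) := Real.exp_pos _
  calc (∫ x in (-L)..L, e (t, x))
      = Real.exp ((B + 2) * t) * (Real.exp (-K * t) * ∫ x in (-L)..L, e (t, x)) := by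
        rw [← mul_assoc, hexp, one_mul]
    _ ≤ Real.exp ((B + 2) * t) * ∫ x in (-L)..L, q (t, x) := mul_le_mul_of_nonneg_left hlow hpos.le
    _ ≤ Real.exp ((B + 2) * t) * ∫ x in (-L)..L, q (0, x) := mul_le_mul_of_nonneg_left key hpos.le

/-- The pointwise inequality behind `energy_late_le`: if `|β_t| ≤ β_x` and `|m| ≤ k`
(`k = u_t² + u_x²`), then `β_t m − β_x k ≤ 0`. -/
theorem late_source_nonpos {bt bx m k : ℝ} (hb : |bt| ≤ bx) (hm : |m| ≤ k) :
    bt * m - bx * k ≤ 0 := by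
  have h1 : bt * m ≤ |bt| * |m| := by
    rw [← abs_mul]; exact le_abs_self _
  have h2 : |bt| * |m| ≤ bx * k :=
    mul_le_mul hb hm (abs_nonneg _) ((abs_nonneg _).trans hb)
  linarith

/-- **Late-time energy bound (the Doppler multiplier).** Let `u` be a `C²` solution of
`u_tt − u_xx + W u = 0` with `W ≥ 0` of class `C¹`, `∂ₜ W ≤ B`, Cauchy data vanishing for
`|y| ≥ R₁`, and let `β` be a `C¹` weight with, on `[T₁, T₂] × ℝ` (`0 ≤ T₁ ≤ T₂`): `|β| ≤ v`,
`|β_t| ≤ β_x`, `β_x W = 0`, `W_t + β W_x = 0`. Then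
`(1 − v) ∫ e(T₂,·) ≤ (1 + v) ∫ e(T₁,·)`. [folklore] -/
theorem energy_late_le (hu : ContDiff ℝ 2 u) (hW : ContDiff ℝ 1 W) (hW0 : ∀ z, 0 ≤ W z)
    {B : ℝ} (hB : ∀ z, fderiv ℝ W z (1, 0) ≤ B)
    (hsol : ∀ z : ℝ × ℝ, fderiv ℝ (fderiv ℝ u) z (1, 0) (1, 0)
      - fderiv ℝ (fderiv ℝ u) z (0, 1) (0, 1) + W z * u z = 0)
    {e : ℝ × ℝ → ℝ}
    (he : ∀ z, e z = (fderiv ℝ u z (1, 0)) ^ 2 + (fderiv ℝ u z (0, 1)) ^ 2 + W z * u z ^ 2)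
    {R₁ : ℝ} (hdata : ∀ y, R₁ ≤ |y| → u (0, y) = 0 ∧ fderiv ℝ u (0, y) (1, 0) = 0)
    {β : ℝ × ℝ → ℝ} (hβ : ContDiff ℝ 1 β) {v T₁ T₂ : ℝ} (hT : 0 ≤ T₁) (hT12 : T₁ ≤ T₂)
    (hβv : ∀ t ∈ Icc T₁ T₂, ∀ x, |β (t, x)| ≤ v)
    (hβtx : ∀ t ∈ Icc T₁ T₂, ∀ x, |fderiv ℝ β (t, x) (1, 0)| ≤ fderiv ℝ β (t, x) (0, 1))
    (hβW : ∀ t ∈ Icc T₁ T₂, ∀ x, fderiv ℝ β (t, x) (0, 1) * W (t, x) = 0)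
    (hkill : ∀ t ∈ Icc T₁ T₂, ∀ x,
      fderiv ℝ W (t, x) (1, 0) + β (t, x) * fderiv ℝ W (t, x) (0, 1) = 0) :
    (1 - v) * ∫ x, e (T₂, x) ≤ (1 + v) * ∫ x, e (T₁, x) := by
  have hWd : Differentiable ℝ W := hW.differentiable (by norm_num)
  have hβd : Differentiable ℝ β := hβ.differentiable (by norm_num)
  have hud := differentiable_of_contDiff_two hu
  set m : ℝ × ℝ → ℝ := fun z => 2 * fderiv ℝ u z (1, 0) * fderiv ℝ u z (0, 1) with hm_def
  set n : ℝ × ℝ → ℝ := fun z =>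
    (fderiv ℝ u z (1, 0)) ^ 2 + (fderiv ℝ u z (0, 1)) ^ 2 - W z * u z ^ 2 with hn_def
  have hm : ∀ z, m z = 2 * fderiv ℝ u z (1, 0) * fderiv ℝ u z (0, 1) := fun z => rfl
  have hn : ∀ z, n z = (fderiv ℝ u z (1, 0)) ^ 2 + (fderiv ℝ u z (0, 1)) ^ 2 - W z * u z ^ 2 :=
    fun z => rfl
  set q : ℝ × ℝ → ℝ := fun z => (1 : ℝ) * e z + (0 : ℝ) * u z ^ 2 + β z * m z with hq_def
  set g : ℝ × ℝ → ℝ := fun z => -((1 : ℝ) * m z + β z * n z) with hg_def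
  have hq : ∀ z, q z = (fun _ => (1 : ℝ)) z * e z + (fun _ => (0 : ℝ)) z * u z ^ 2 + β z * m z :=
    fun z => rfl
  have hg : ∀ z, g z = -((fun _ => (1 : ℝ)) z * m z + β z * n z) := fun z => rfl
  have hqd := differentiable_weighted hu hWd he hm (differentiable_const 1) (differentiable_const 0)
    hβd hq
  have hgd := differentiable_weightedFlux hu hWd hm hn (differentiable_const 1) hβd hg
  set d : ℝ × ℝ → ℝ := fun z => fderiv ℝ β z (1, 0) * m z - fderiv ℝ β z (0, 1) * n z
    + (fderiv ℝ W z (1, 0) + β z * fderiv ℝ W z (0, 1)) * u z ^ 2 with hd_def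
  have hdiv : ∀ z, fderiv ℝ q z (1, 0) + fderiv ℝ g z (0, 1) = d z := by
    intro z
    rw [divergence_weighted hu hWd hsol he hm hn (differentiable_const 1) (differentiable_const 0)
      hβd hq hg z]
    have h0 : fderiv ℝ (fun _ : ℝ × ℝ => (0 : ℝ)) z = 0 := by simp
    have h1 : fderiv ℝ (fun _ : ℝ × ℝ => (1 : ℝ)) z = 0 := by simp
    simp only [hd_def, h0, h1, zero_apply]
    ring
  have hdc : Continuous d := by
    have h1 := continuous_fderiv_apply hu (1, 0)
    have h3 : Continuous fun z : ℝ × ℝ => fderiv ℝ W z (1, 0) :=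
      (hW.continuous_fderiv (by norm_num)).clm_apply continuous_const
    have h4 : Continuous fun z : ℝ × ℝ => fderiv ℝ W z (0, 1) :=
      (hW.continuous_fderiv (by norm_num)).clm_apply continuous_const
    have h5 : Continuous fun z : ℝ × ℝ => fderiv ℝ β z (1, 0) :=
      (hβ.continuous_fderiv (by norm_num)).clm_apply continuous_const
    have h6 : Continuous fun z : ℝ × ℝ => fderiv ℝ β z (0, 1) :=
      (hβ.continuous_fderiv (by norm_num)).clm_apply continuous_const
    have h7 := (differentiable_momentumDensity hu hm).continuous
    have h8 := continuous_lagr hu hW.continuous hn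
    have h9 := hβ.continuous
    simp only [hd_def]
    fun_prop
  have hdneg : ∀ t ∈ Icc T₁ T₂, ∀ x, d (t, x) ≤ 0 := by
    intro t ht x
    have hkin := abs_momentum_le_kinetic hm (t, x)
    have h1 := late_source_nonpos (hβtx t ht x) hkin
    have h2 := hβW t ht x
    have h3 := hkill t ht x
    simp only [hd_def, hn_def, h3, zero_mul, add_zero]
    nlinarith [h2, sq_nonneg (u (t, x))]
  -- supports
  set L : ℝ := |R₁| + T₂ + 1 with hL
  have hL0 : 0 ≤ L := by have := abs_nonneg R₁; linarith
  have hvan : ∀ s, 0 ≤ s → s ≤ T₂ → ∀ y, L ≤ |y| → ∀ w, u (s, y) = 0 ∧ fderiv ℝ u (s, y) w = 0 :=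
    fun s hs hsT y hy w => eq_zero_of_abs_ge hu hW hW0 hB hsol hdata hs
      (le_trans (by linarith [le_abs_self R₁]) hy) w
  have key := integral_rect_le hqd hgd hdc hdiv hL0 hT12
    (fun s hs x _ => hdneg s hs x)
    (fun s hs => by
      have hp := hvan s (hT.trans hs.1) hs.2 L (le_abs_self L)
      have hn' := hvan s (hT.trans hs.1) hs.2 (-L) (by simp [abs_neg, le_abs_self])
      simp only [hg_def, hm_def, hn_def, (hp (1, 0)).2, (hp (0, 1)).2, (hp (1, 0)).1,
        (hn' (1, 0)).2, (hn' (0, 1)).2, (hn' (1, 0)).1]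
      ring)
  -- coercivity `(1 - v) e ≤ q ≤ (1 + v) e` on `[T₁, T₂]`
  have hec : Continuous e := continuous_energy hu hW.continuous he
  have hcoer : ∀ t ∈ Icc T₁ T₂, ∀ x, (1 - v) * e (t, x) ≤ q (t, x) ∧ q (t, x) ≤ (1 + v) * e (t, x) := by
    intro t ht x
    have hkin := abs_momentum_le_kinetic hm (t, x)
    have hke := kinetic_le_energy hW0 he (t, x)
    have hb := hβv t ht x
    have hprod : |β (t, x) * m (t, x)| ≤ v * e (t, x) := by
      rw [abs_mul]
      exact mul_le_mul hb (hkin.trans hke) (abs_nonneg _) ((abs_nonneg _).trans hb)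
    have h1 := neg_abs_le (β (t, x) * m (t, x))
    have h2 := le_abs_self (β (t, x) * m (t, x))
    simp only [hq_def]
    constructor <;> nlinarith
  have hlow : (1 - v) * (∫ x in (-L)..L, e (T₂, x)) ≤ ∫ x in (-L)..L, q (T₂, x) := by
    rw [← intervalIntegral.integral_const_mul]
    refine intervalIntegral.integral_mono_on (by linarith) ?_ ?_
      fun x _ => (hcoer T₂ ⟨hT12, le_rfl⟩ x).1
    · exact ((hec.comp (Continuous.prodMk_right T₂)).const_mul _).intervalIntegrable _ _
    · exact (hqd.continuous.comp (Continuous.prodMk_right T₂)).intervalIntegrable _ _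
  have hup : (∫ x in (-L)..L, q (T₁, x)) ≤ (1 + v) * ∫ x in (-L)..L, e (T₁, x) := by
    rw [← intervalIntegral.integral_const_mul]
    refine intervalIntegral.integral_mono_on (by linarith) ?_ ?_
      fun x _ => (hcoer T₁ ⟨le_rfl, hT12⟩ x).2
    · exact (hqd.continuous.comp (Continuous.prodMk_right T₁)).intervalIntegrable _ _
    · exact ((hec.comp (Continuous.prodMk_right T₁)).const_mul _).intervalIntegrable _ _
  have hE : ∀ s, 0 ≤ s → s ≤ T₂ → ∫ x, e (s, x) = ∫ x in (-L)..L, e (s, x) := by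
    intro s hs hsT
    refine integral_eq_intervalIntegral_of_abs fun y hy => ?_
    have h := hvan s hs hsT y hy
    rw [he, (h (1, 0)).2, (h (0, 1)).2, (h (1, 0)).1]
    ring
  rw [hE T₂ (hT.trans hT12) le_rfl, hE T₁ hT hT12]
  linarith

end MovingWells

end

end Summit.FinalStateConjecture.FinalStateConjecture.Theorems
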